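import Mathlib
import HarnessLib
import Summits.NavierStokesRegularity.NavierStokesRegularity.Theorems.PoloidalWindowRigidity.Negative.ResidueFalseWithClassRates

/-!
# Crux `PoloidalWindowRigidity` (K2, stmt-NavierStokesRegularity-19708) — negative side:
# the sign in the proportional-shear / constant-Clebsch-slope stratum lemma is load-bearing modulo (M)

Negative-side support (refuter seat ns-regularity-refuter1, cell ns-regularity-ideate; D-0081 §C), companion of
`…Negative.DriftProfile` / `…Negative.ResidueFalseWithClassRates`.

The settled stratum of `…Theorems.PoloidalWindowDoorPoloidalWindowRigidityProportionalShear` (seat K2-p1,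
p463086): in the Type-I Oseen-mild poloidal class, PROPORTIONAL SHEAR `∂₂v_h ≡ μ ∇_h v₂` with a constant `μ > 0`
(equivalently constant Clebsch slope `λ ∉ [0,1]`, `μ = 1 − 1/λ`) forces `v ≡ 0` — by slice kinematics alone (the
anisotropically rescaled slice is curl-free, divergence-free and bounded). The complementary HYPERBOLIC half `μ < 0`
(`λ ∈ (0,1)`) was left open («task H4b»).

This file certifies that the hyperbolic half is NOT empty kinematically, even with the scale-sharp rates: the cellular
field `V` has `∂₂V_h = −∇_h V₂` identically — proportional shear with `μ = −1`, constant Clebsch slope `λ = 1/2` —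
and so do the separated cellular profile `(−t)^{-1/2} V` and the drifting discretely self-similar profile
`w(t,x) = (−t)^{-1/2} V((−t)^{-1/2}x + log(−t) e₁)` on every slice (`proportionalShear_cellProfile`,
`clebschSlope_cellProfile`, `proportionalShear_driftProfile`, `clebschSlope_driftProfile`). Consequently
(`proportionalShear_false_without_sign_with_classRates_without_mild`,
`clebschSlope_false_inside_with_classRates_without_mild`): K2-p1's `nonflatLiouville_of_proportionalShear` /
`eq_zero_of_clebschSlope_const` with the sign condition `0 < μ` replaced by `μ ≠ 0` (resp. `λ < 0 ∨ 1 < λ` replaced by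
`0 < λ < 1`) and the Oseen-mild identity (M) replaced by the two ClassRate bounds `‖Dv(t)(y)‖ ≤ C₁/(−t)`,
`‖curl v(t)(y)‖ ≤ C₂/(−t)` are FALSE: the witness `w` is Type-I (C = 4), continuous on the slab, rate-sharp
(C₁ = 8, C₂ = 4), divergence-free, poloidal, and backward-singular at the apex.

MESSAGE for the K2 line: on the elliptic half the sign does the work and (M) is idle; on the hyperbolic half nothing
kinematic or rate-level is left — emptying `{λ ∈ (0,1)}` (K2-p1's H4b) must use (M) structurally.

WHAT THIS IS NOT: not a claim about Navier–Stokes and not a refutation of any registered item — tightness of a settled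
stratum lemma. [folklore]
-/

noncomputable section

namespace Summit.NavierStokesRegularity.NavierStokesRegularity.Theorems.PoloidalWindowRigidity.Negative

open MeasureTheory Set Function Filter Topology Metric
open scoped RealInnerProductSpace InnerProductSpace ENNReal NNReal
open Literature.Analysis Literature.Analysis.FluidPDE

/-! ## Proportional shear with `μ = −1` / Clebsch slope `1/2` on the cellular profiles -/

/-- `(DV(y) e₂)₀ = −cos y₀ sin y₂`. [folklore] -/
theorem cellDeriv_single_two_apply_zero (y : EuclideanSpace ℝ (Fin 3)) :
    cellDeriv y (EuclideanSpace.single 2 (1 : ℝ)) 0 = -(Real.cos (y 0) * Real.sin (y 2)) := by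
  rw [cellDeriv_apply_zero]
  simp

/-- `(DV(y) e₂)₁ = −cos y₁ sin y₂`. [folklore] -/
theorem cellDeriv_single_two_apply_one (y : EuclideanSpace ℝ (Fin 3)) :
    cellDeriv y (EuclideanSpace.single 2 (1 : ℝ)) 1 = -(Real.cos (y 1) * Real.sin (y 2)) := by
  rw [cellDeriv_apply_one]
  simp

/-- `(DV(y) e₀)₂ = sin y₂ cos y₀`. [folklore] -/
theorem cellDeriv_single_zero_apply_two (y : EuclideanSpace ℝ (Fin 3)) :
    cellDeriv y (EuclideanSpace.single 0 (1 : ℝ)) 2 = Real.sin (y 2) * Real.cos (y 0) := by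
  rw [cellDeriv_apply_two]
  simp

/-- `(DV(y) e₁)₂ = sin y₂ cos y₁`. [folklore] -/
theorem cellDeriv_single_one_apply_two (y : EuclideanSpace ℝ (Fin 3)) :
    cellDeriv y (EuclideanSpace.single 1 (1 : ℝ)) 2 = Real.sin (y 2) * Real.cos (y 1) := by
  rw [cellDeriv_apply_two]
  simp

/-- The separated cellular profile has proportional shear with `μ = −1`: `∂₂v₀ = −∂₀v₂`, `∂₂v₁ = −∂₁v₂`
(K2-p1's `hshear` shape). [folklore] -/
theorem proportionalShear_cellProfile (s : ℝ) (y : EuclideanSpace ℝ (Fin 3)) :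
    fderiv ℝ (cellProfile s) y (EuclideanSpace.single 2 (1 : ℝ)) 0 =
        (-1) * fderiv ℝ (cellProfile s) y (EuclideanSpace.single 0 (1 : ℝ)) 2 ∧
      fderiv ℝ (cellProfile s) y (EuclideanSpace.single 2 (1 : ℝ)) 1 =
        (-1) * fderiv ℝ (cellProfile s) y (EuclideanSpace.single 1 (1 : ℝ)) 2 := by
  constructor
  · rw [fderiv_cellProfile_apply, fderiv_cellProfile_apply, cellDeriv_single_two_apply_zero,
      cellDeriv_single_zero_apply_two]
    ring
  · rw [fderiv_cellProfile_apply, fderiv_cellProfile_apply, cellDeriv_single_two_apply_one,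
      cellDeriv_single_one_apply_two]
    ring

/-- The separated cellular profile has constant Clebsch slope `λ = 1/2`: `∂₀v₂ = −λ ω₁`, `∂₁v₂ = λ ω₀`
(K2-p1's `hslope` shape). [folklore] -/
theorem clebschSlope_cellProfile (s : ℝ) (y : EuclideanSpace ℝ (Fin 3)) :
    fderiv ℝ (cellProfile s) y (EuclideanSpace.single 0 (1 : ℝ)) 2 = -((1 / 2) * curl (cellProfile s) y 1) ∧
      fderiv ℝ (cellProfile s) y (EuclideanSpace.single 1 (1 : ℝ)) 2 = (1 / 2) * curl (cellProfile s) y 0 := by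
  constructor
  · rw [fderiv_cellProfile_apply, cellDeriv_single_zero_apply_two, curl_cellProfile_apply_one]
    ring
  · rw [fderiv_cellProfile_apply, cellDeriv_single_one_apply_two, curl_cellProfile_apply_zero]
    ring

/-- The drifting discretely self-similar profile has proportional shear with `μ = −1` on every slice. [folklore] -/
theorem proportionalShear_driftProfile (s : ℝ) (y : EuclideanSpace ℝ (Fin 3)) :
    fderiv ℝ (driftProfile s) y (EuclideanSpace.single 2 (1 : ℝ)) 0 =
        (-1) * fderiv ℝ (driftProfile s) y (EuclideanSpace.single 0 (1 : ℝ)) 2 ∧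
      fderiv ℝ (driftProfile s) y (EuclideanSpace.single 2 (1 : ℝ)) 1 =
        (-1) * fderiv ℝ (driftProfile s) y (EuclideanSpace.single 1 (1 : ℝ)) 2 := by
  constructor
  · rw [fderiv_driftProfile_apply, fderiv_driftProfile_apply, cellDeriv_single_two_apply_zero,
      cellDeriv_single_zero_apply_two]
    ring
  · rw [fderiv_driftProfile_apply, fderiv_driftProfile_apply, cellDeriv_single_two_apply_one,
      cellDeriv_single_one_apply_two]
    ring

/-- The drifting discretely self-similar profile has constant Clebsch slope `λ = 1/2` on every slice. [folklore] -/
theorem clebschSlope_driftProfile (s : ℝ) (y : EuclideanSpace ℝ (Fin 3)) :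
    fderiv ℝ (driftProfile s) y (EuclideanSpace.single 0 (1 : ℝ)) 2 = -((1 / 2) * curl (driftProfile s) y 1) ∧
      fderiv ℝ (driftProfile s) y (EuclideanSpace.single 1 (1 : ℝ)) 2 = (1 / 2) * curl (driftProfile s) y 0 := by
  constructor
  · rw [fderiv_driftProfile_apply, cellDeriv_single_zero_apply_two, curl_driftProfile_apply_one]
    ring
  · rw [fderiv_driftProfile_apply, cellDeriv_single_one_apply_two, curl_driftProfile_apply_zero]
    ring

/-! ## The sign is load-bearing modulo (M) -/

/-- **K2-p1's proportional-shear stratum lemma with the sign `0 < μ` weakened to `μ ≠ 0` and (M) replaced by the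
ClassRate rates is FALSE**: the drifting cellular profile (`μ = −1`) is Type-I (`C = 4`), continuous, rate-sharp
(`C₁ = 8`, `C₂ = 4`), divergence-free, poloidal, proportionally sheared, and backward-singular at the apex. The
hypothesis list is that of `…ProportionalShear.nonflatLiouville_of_proportionalShear` with `hmild` replaced by the two
rate bounds and `hμ : 0 < μ` replaced by `μ ≠ 0`. [folklore] -/
theorem proportionalShear_false_without_sign_with_classRates_without_mild :
    ¬ (∀ (C C₁ C₂ : ℝ) (v : ℝ → EuclideanSpace ℝ (Fin 3) → EuclideanSpace ℝ (Fin 3)),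
      Literature.Analysis.FluidPDE.HasTypeITimeDecay C v →
      ContinuousOn (Function.uncurry v) (Set.Iio (0 : ℝ) ×ˢ Set.univ) →
      (∀ t < 0, ∀ y, ‖fderiv ℝ (v t) y‖ ≤ C₁ / (-t)) →
      (∀ t < 0, ∀ y, ‖Literature.Analysis.FluidPDE.curl (v t) y‖ ≤ C₂ / (-t)) →
      (∀ t < 0, Literature.Analysis.FluidPDE.VectorCalculus.IsDivFree (v t)) →
      (∀ s < 0, ∀ y, ⟪Literature.Analysis.FluidPDE.curl (v s) y, EuclideanSpace.single 2 1⟫_ℝ = 0) →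
      ∀ μ : ℝ, μ ≠ 0 →
      (∀ s < 0, ∀ y, fderiv ℝ (v s) y (EuclideanSpace.single 2 (1 : ℝ)) 0 =
          μ * fderiv ℝ (v s) y (EuclideanSpace.single 0 (1 : ℝ)) 2 ∧
        fderiv ℝ (v s) y (EuclideanSpace.single 2 (1 : ℝ)) 1 =
          μ * fderiv ℝ (v s) y (EuclideanSpace.single 1 (1 : ℝ)) 2) →
      ¬ Literature.Analysis.FluidPDE.IsBackwardSingularPoint v 0) := by
  intro h
  exact h 4 8 4 driftProfile hasTypeITimeDecay_driftProfile continuousOn_driftProfile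
    (fun t ht y => norm_fderiv_driftProfile_le ht y) (fun t ht y => norm_curl_driftProfile_le ht y)
    (fun t _ => isDivFree_driftProfile t) (fun s _ y => poloidal_driftProfile s y) (-1) (by norm_num)
    (fun s _ y => proportionalShear_driftProfile s y) isBackwardSingularPoint_driftProfile

/-- **K2-p1's constant-Clebsch-slope lemma with `λ < 0 ∨ 1 < λ` replaced by `0 < λ < 1` and (M) replaced by the
ClassRate rates is FALSE** (witness: the drifting cellular profile, `λ = 1/2`). The hypothesis list is that of
`…ProportionalShear.eq_zero_of_clebschSlope_const` with `hmild` replaced by the two rate bounds, `hlam` replaced by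
`0 < lam ∧ lam < 1`, and the conclusion weakened to «not backward-singular at the apex». [folklore] -/
theorem clebschSlope_false_inside_with_classRates_without_mild :
    ¬ (∀ (C C₁ C₂ : ℝ) (v : ℝ → EuclideanSpace ℝ (Fin 3) → EuclideanSpace ℝ (Fin 3)),
      Literature.Analysis.FluidPDE.HasTypeITimeDecay C v →
      ContinuousOn (Function.uncurry v) (Set.Iio (0 : ℝ) ×ˢ Set.univ) →
      (∀ t < 0, ∀ y, ‖fderiv ℝ (v t) y‖ ≤ C₁ / (-t)) →
      (∀ t < 0, ∀ y, ‖Literature.Analysis.FluidPDE.curl (v t) y‖ ≤ C₂ / (-t)) →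
      (∀ t < 0, Literature.Analysis.FluidPDE.VectorCalculus.IsDivFree (v t)) →
      (∀ s < 0, ∀ y, ⟪Literature.Analysis.FluidPDE.curl (v s) y, EuclideanSpace.single 2 1⟫_ℝ = 0) →
      ∀ lam : ℝ, 0 < lam ∧ lam < 1 →
      (∀ s < 0, ∀ y, fderiv ℝ (v s) y (EuclideanSpace.single 0 (1 : ℝ)) 2 =
          -(lam * Literature.Analysis.FluidPDE.curl (v s) y 1) ∧
        fderiv ℝ (v s) y (EuclideanSpace.single 1 (1 : ℝ)) 2 =
          lam * Literature.Analysis.FluidPDE.curl (v s) y 0) →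
      ¬ Literature.Analysis.FluidPDE.IsBackwardSingularPoint v 0) := by
  intro h
  exact h 4 8 4 driftProfile hasTypeITimeDecay_driftProfile continuousOn_driftProfile
    (fun t ht y => norm_fderiv_driftProfile_le ht y) (fun t ht y => norm_curl_driftProfile_le ht y)
    (fun t _ => isDivFree_driftProfile t) (fun s _ y => poloidal_driftProfile s y) (1 / 2)
    ⟨by norm_num, by norm_num⟩ (fun s _ y => clebschSlope_driftProfile s y) isBackwardSingularPoint_driftProfile

end Summit.NavierStokesRegularity.NavierStokesRegularity.Theorems.PoloidalWindowRigidity.Negative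

end
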